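import Summits.BirchSwinnertonDyer.BirchSwinnertonDyer.Theorems.KatoDescentPotSupersingularReducibleTameShaBound
import Summits.BirchSwinnertonDyer.BirchSwinnertonDyer.Theorems.KatoDescentPotSupersingularReducibleShaBoundWildControl
import Literature.NumberTheory.EllipticCurves.IwasawaTowerTorsionFiniteProofs
import HarnessLib

/-!
# THE J-ROAD BEYOND THE TAME ROWS, II: with the inexact fine control `#Sel_str(ℚ, W[p^∞]) ≤ #W(ℚ̄)[p^∞]^{Γ_ℚ} · #Sel₀(ℚ_∞, W[p^∞])^Γ`
# (no hypothesis at `p` beyond `W(ℚ_∞)[p^∞]` finite) and crux M's inequality on EVERY reducible non-CM rank-0 row with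
# `W(ℚ_{p,∞})[p^∞]` finite — wild `p = 3` included — modulo (b′) on the pinned zeta class:
# `ord_p #Ш(W)[p^∞] + v_p(Tam W) ≤ e + v_p(c_p) + 3·v_p #W(ℚ)_tors` (crux M 19196)

Seat `bsd-potss-rkm` g28 (prover, cell `bsd-potss`), item stmt-BirchSwinnertonDyer-19196 `ReducibleKatoMember` = crux M of K9
`KatoDescentPotSupersingular` (support; the WILD prime `3`) / K8-t′ `KatoDescentTamePotSupersingular` (auto-crux); `--supports … --as
helper`; route-free; closes nothing.  HONEST FRAMING: BSD is not proved by any of this; nothing is booked; crux M stays cite-level on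
{modularity, HELD 27962}; theorems only (no definition, no named fact, no `sorry`).

## What and why

The prequels (`…ReducibleH2DescentCount{,Strict}`, `…ReducibleTameShaBound`) prove Kato's Thm. 14.5 (3) at level `0` and crux M's
inequality modulo (b′) on the rows with `W(ℚ_p)[p] = 0`, where g27's EXACT fine control `Sel_str(ℚ, W[p^∞]) ≅ Sel₀(ℚ_∞, W[p^∞])^Γ`
holds.  On K9's wild rows (`p = 3`, `W[3]` reducible, often `W(ℚ_3)[3] ≠ 0`) exact control fails, but the INEQUALITY survives: the
restriction `H¹(ℚ, W[p^∞]) → H¹(ℚ_∞, W[p^∞])` sends Kato's strict Selmer group INTO the `Γ`-invariants of the fine Selmer group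
(§1: Kato's strict condition at `p` trivially implies the fine one; at `ℓ ≠ p` unramified ⟹ trivial over the tower is g27's pro-`p′`
lemma; conjugates of a level-`0` class coincide), with kernel inside `ker(H¹(ℚ, W[p^∞]) → H¹(ℚ_∞, W[p^∞])) = H¹(Γ, W(ℚ_∞)[p^∞])`, of
order `#W(ℚ̄)[p^∞]^{Γ_ℚ} = #W(ℚ)[p^∞]` when `W(ℚ_∞)[p^∞]` is finite (Greenberg L.3.1/L.4.3, tree
`WeierstrassCurve.natCard_ker_layerToInfty_eq_natCard_fixedPoints`).  Hence

* PREQUEL `…ReducibleShaBoundWildControl` (same namespace): §1 Galois descent `#W(ℚ̄)[p^∞]^{Γ_ℚ} ∣ #W(ℚ)_tors`, local ⟹ global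
  finiteness; §2 the inexact control `natCard_katoStrictSelmer_le_mul`.
* §3 **`padicValNat_sha_add_tamagawa_le_of_zetaLineOrthIndexAt_of_fineSelmer_dvd`** — for ANY class `y` with `[A : ℤ_p y₀]` finite and
  divisible by `#Sel₀(ℚ_∞)^Γ` (the J-road count of `…ReducibleH2DescentCount`), and any `e` with (b′):
  `ord_p #Ш(W)[p^∞] + v_p(Tam W) ≤ e + v_p(c_p) + 2·v_p #W(ℚ)_tors + v_p #W(ℚ̄)[p^∞]^{Γ_ℚ} ≤ e + v_p(c_p) + 3·v_p #W(ℚ)_tors`;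
* §4 **`exists_zetaLift_padicValNat_sha_add_tamagawa_le_of_zetaLineOrthIndexAt_of_finite`** — on EVERY reducible non-CM rank-0 row
  (`p ≠ 2`, no reduction hypothesis at all) with `W(ℚ_{p,∞})[p^∞]` finite (H2X's hypothesis; Imai 1975 at a potentially good `p`, NOT a
  tree theorem at the wild prime): Kato's zeta lift `𝐲` satisfies `∀ e, ZetaLineOrthIndexAt W p 𝐲₀ e → ord_p #Ш + v_p Tam ≤ e + v_p(c_p) +
  3·v_p #W(ℚ)_tors`, modulo {H2X, Z0, 13.4, Serre, FW, Lim 3.5}; and the LIFT form `…_zetaLift_of_finite`.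

READING (K9).  This is M's printed SHAPE (`… ≤ ord_p(L/Ω) + 3·ord_p #tors` once (b′) gives `e`), but on the wild rows Kato's
`e = ord_p(L(W,1)/Ω) + v_p(λ(0)) + t_p − v_p(c_p)` carries `t_p = ord_p #W(ℚ_p)[p^∞] > 0`, which Kato cancels against the local term of
(14.9.3)/(c2′) (`#𝐇²_Γ/T = #Sel_str · p^{t_p − t₀}`) — a TWO-sided statement about `𝐇² ⊋ X₀` that the one-sided J-road cannot see
(H2X forgets the cokernel).  So on K9's rows the J-road gives M up to `p^{t_p}`; K9's M stays over 27962 (planner TARGET R294), and this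
file records exactly how far the atomic facts reach there.

References: K. Kato, Astérisque 295 (2004), Thm. 14.5 (p. 236), (14.9.3) (p. 240), §14.14 (pp. 243–244), Prop. 14.16 (2) (pp. 244–245),
Lemma 14.18 (pp. 247–248) [Kato2004Asterisque]; R. Greenberg, LNM 1716 (1999), §3 Lemma 3.1 (p. 86), §4 Lemma 4.3 (p. 103)
[GreenbergLNM1716]; H. Imai, Proc. Japan Acad. 51 (1975) 12–16 [Imai1975] (scope remark only); J. S. Milne, *ADT* I Thm. 4.10 (b) [MilneADT2006].
-/

-- the summit and its single problem are both named `BirchSwinnertonDyer` (registry layout D-0017)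
set_option linter.dupNamespace false
set_option autoImplicit false

noncomputable section

open scoped Classical ContRepresentation NumberField TensorProduct
open CategoryTheory Function Field NumberField IsDedekindDomain WeierstrassCurve CongruenceSubgroup
open Literature.NumberTheory.EllipticCurves Literature.NumberTheory.GaloisRepresentations
  Literature.NumberTheory.GaloisRepresentations.DiscreteGaloisModule Literature.NumberTheory.GaloisCohomology
open Literature.NumberTheory.EllipticCurves.GreenbergSelmer
open Literature.NumberTheory.EllipticCurves.ModularForms
open Literature.NumberTheory.EllipticCurves.Kato2004 Literature.NumberTheory.EllipticCurves.Kato2004.EulerSystemValues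
open Literature.NumberTheory.EllipticCurves.IwasawaAlgebra Literature.NumberTheory.EllipticCurves.IwasawaDual
open Literature.NumberTheory.EllipticCurves.Rank1Residual
open Summit.BirchSwinnertonDyer.Rank1Residual
open Summit.BirchSwinnertonDyer.Rank1Residual.X11b.Levels Summit.BirchSwinnertonDyer.Rank1Residual.X11b.LocBridge
  Summit.BirchSwinnertonDyer.Rank1Residual.X11b.AcSelmer
open Summit.BirchSwinnertonDyer.BirchSwinnertonDyer.Theorems
open Summit.BirchSwinnertonDyer.BirchSwinnertonDyer.Theorems.ASideJunction
open Summit.BirchSwinnertonDyer.BirchSwinnertonDyer.Theorems.KatoFiniteLevelCount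
open Summit.BirchSwinnertonDyer.BirchSwinnertonDyer.Theorems.StrictSelmerBridge
open Summit.BirchSwinnertonDyer.BirchSwinnertonDyer.Theorems.IntegralH1LayerZeroTop
open Summit.BirchSwinnertonDyer.BirchSwinnertonDyer.Theorems.ExactFineControlLocal
open Summit.BirchSwinnertonDyer.BirchSwinnertonDyer.Theorems.ExactFineControl

namespace Summit.BirchSwinnertonDyer.BirchSwinnertonDyer.Theorems.ReducibleShaBoundWild

/-! ## §3 The bound from (b′), the fine count `#Sel₀(ℚ_∞)^Γ ∣ [A : ℤ_p y₀]` and the inexact control -/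

section Bound

variable (W : WeierstrassCurve ℚ) [W.IsElliptic] (p : ℕ) [Fact p.Prime]
  [ContinuousSMul ℤ_[p] (W.tateModule p)] [Finite W.toAffine.Point] [Finite (AddCommGroup.primaryComponent W.sha p)]
  {κ : ZpExtension ℚ p} {γ : absoluteGaloisGroup ℚ}

/-- **`ord_p #Ш(W)[p^∞] + v_p(Tam W) ≤ e + v_p(c_p) + 2·v_p #W(ℚ)_tors + v_p #W(ℚ̄)[p^∞]^{Γ_ℚ}`** for every class `y ∈ 𝐇¹_Γ(T_pW)` with
`[H¹(ℤ[1/p],T_pW) : ℤ_p y₀]` finite and DIVISIBLE BY `#Sel₀(ℚ_∞, W[p^∞])^Γ` (the J-road count), `Sel₀(ℚ_∞)^Γ` finite, and every `e`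
with (b′) `ZetaLineOrthIndexAt W p (layerZeroToTop y₀) e` (`p` odd, `κ` cyclotomic; `W(ℚ_∞)[p^∞]` is finite for EVERY `E/ℚ` — tree theorem
`WeierstrassCurve.finite_fixedPoints_kerSubgroup_geomPrimaryTorsion_rat`, seat rkm g6).  The Poitou–Tate ledger (part 58, PT over `ℚ` a kernel
theorem) + the prequel's inexact control.  No named fact in the binders; no hypothesis at `p` on `W`.
[cite: Kato2004Asterisque, Thm. 14.5 (3) (p. 236), (14.9.3) (p. 240), Prop. 14.16 (2) and its proof (pp. 244–245), Lemma 14.18 (pp. 247–248)]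
[cite: GreenbergLNM1716, §3 Lemma 3.1, §4 Lemma 4.3] [cite: MilneADT2006, Ch. I, Cor. 2.3, Thm. 4.10 (b)] -/
theorem padicValNat_sha_add_tamagawa_le_of_zetaLineOrthIndexAt_of_fineSelmer_dvd (hodd : p ≠ 2) (hκ : κ.IsCyclotomic)
    (I : IwasawaH1Data W p κ γ) (y : I.H)
    (hfinS : Finite (IwasawaDual.endInvariants (W.conjFineSelmerInfty κ γ - 1)))
    (hfin : Finite (integralH1 (tateRep W p) p (κ.layerSubgroup 0) ⧸
      Submodule.span ℤ_[p] {(⟨I.proj 0 y, I.proj_mem 0 y⟩ : integralH1 (tateRep W p) p (κ.layerSubgroup 0))}))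
    (hdvd : Nat.card (IwasawaDual.endInvariants (W.conjFineSelmerInfty κ γ - 1)) ∣
      Nat.card (integralH1 (tateRep W p) p (κ.layerSubgroup 0) ⧸
        Submodule.span ℤ_[p] {(⟨I.proj 0 y, I.proj_mem 0 y⟩ : integralH1 (tateRep W p) p (κ.layerSubgroup 0))}))
    (e : ℕ) (hb : ZetaLineOrthIndexAt W p (layerZeroToTop W p κ (I.proj 0 y)) e) :
    padicValNat p (Nat.card (AddCommGroup.primaryComponent W.sha p)) + padicValNat p W.tamagawaProduct ≤
      e + padicValNat p ((W.baseChange ((primePlace p).adicCompletion ℚ)).localTamagawaNumber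
          ((primePlace p).adicCompletionIntegers ℚ)) + 2 * padicValNat p W.torsionOrder +
        padicValNat p (Nat.card {m : W.geomPrimaryTorsion p | ∀ σ ∈ κ.layerSubgroup 0, σ • m = m}) := by
  have hp : p.Prime := Fact.out
  -- `W(ℚ_∞)[p^∞]` is finite for EVERY `E/ℚ`, `p`, `ℤ_p`-extension (tree theorem, seat rkm g6)
  haveI := W.finite_fixedPoints_kerSubgroup_geomPrimaryTorsion_rat κ
  have hPT : poitouTate_selmerStructure_duality ℚ :=
    poitouTate_selmerStructure_duality_of_conj (InputsPoitouTateSelmer.poitouTate_selmerStructure_duality_conj_holds ℚ)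
  -- the zeta line at `⊤` and the index in the ledger currency
  set y₀ : H1 (tateRep W p) ⊤ := layerZeroToTop W p κ (I.proj 0 y) with hy₀def
  have hy₀ : y₀ ∈ integralH1 (tateRep W p) p ⊤ := layerZeroToTop_mem_integralH1 W p κ (I.proj_mem 0 y)
  have hrel := ReducibleTameShaBound.natCard_quotient_span_layerZero_eq_relIndex_top I y
  have hidx0 : Nat.card (integralH1 (tateRep W p) p (κ.layerSubgroup 0) ⧸
      Submodule.span ℤ_[p] {(⟨I.proj 0 y, I.proj_mem 0 y⟩ : integralH1 (tateRep W p) p (κ.layerSubgroup 0))}) ≠ 0 :=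
    Nat.card_pos.ne'
  have hrel0 : (ℤ_[p] ∙ y₀).toAddSubgroup.relIndex (integralH1 (tateRep W p) p ⊤).toAddSubgroup ≠ 0 := hrel ▸ hidx0
  obtain ⟨N, hN⟩ := exists_pow_smul_mem_span_singleton_of_relIndex_ne_zero (integralH1 (tateRep W p) p ⊤) y₀ hy₀ hrel0
  -- the strict-unramified and relaxed-unramified structures, the finite set of bad places
  obtain ⟨𝓢inf, hSp, hSur, hSinl⟩ : ∃ 𝓢 : SelmerStructure (primaryGaloisModule W p),
      𝓢 (Sum.inr (primePlace p)) = ⊥ ∧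
      (∀ v : HeightOneSpectrum (𝓞 ℚ), v ≠ primePlace p →
        𝓢 (Sum.inr v) = unramifiedSubgroup (GaloisRep.toLocal v (primaryGaloisModule W p)) 1) ∧
      ∀ w : InfinitePlace ℚ, 𝓢 (Sum.inl w) = ⊤ :=
    ⟨fun v => match v with
      | Sum.inl _ => ⊤
      | Sum.inr v => if v = primePlace p then ⊥ else unramifiedSubgroup (GaloisRep.toLocal v (primaryGaloisModule W p)) 1,
     if_pos rfl, fun v hv => if_neg hv, fun _ => rfl⟩
  obtain ⟨𝓤inf, hUp, hUur, hUinl⟩ : ∃ 𝓤 : SelmerStructure (primaryGaloisModule W p),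
      𝓤 (Sum.inr (primePlace p)) = ⊤ ∧
      (∀ v : HeightOneSpectrum (𝓞 ℚ), v ≠ primePlace p →
        𝓤 (Sum.inr v) = unramifiedSubgroup (GaloisRep.toLocal v (primaryGaloisModule W p)) 1) ∧
      ∀ w : InfinitePlace ℚ, 𝓤 (Sum.inl w) = ⊤ :=
    ⟨fun v => match v with
      | Sum.inl _ => ⊤
      | Sum.inr v => if v = primePlace p then ⊤ else unramifiedSubgroup (GaloisRep.toLocal v (primaryGaloisModule W p)) 1,
     if_pos rfl, fun v hv => if_neg hv, fun _ => rfl⟩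
  obtain ⟨S, hS⟩ : ∃ S : Finset (HeightOneSpectrum (𝓞 ℚ)), ∀ v, v ∉ S → W.HasGoodReductionAt v := by
    have h := WeierstrassCurve.eventually_hasGoodReductionAt W
    rw [Filter.eventually_cofinite] at h
    exact ⟨h.toFinset, fun v hv => by_contra fun hbad => hv (h.mem_toFinset.mpr hbad)⟩
  -- part 58: the level-0 count in naturals; part 59: the strict group in the Literature currency
  have h58 := tamagawa_mul_sha_mul_index_le_ppart_of_zetaLineOrthIndexAt W p 𝓤inf 𝓢inf hPT hodd (insert (primePlace p) S)
    (Finset.mem_insert_self _ _) (fun v hv => hS v fun h => hv (Finset.mem_insert_of_mem h)) hUp hUur hUinl hSp hSur hSinl y₀ hy₀ N hN e hb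
  have h59 : Nat.card 𝓢inf.selmerGroup = Nat.card (katoStrictSelmer W p {primePlace p}) :=
    natCard_selmerGroup_eq_natCard_katoStrictSelmer W p 𝓢inf hSp hSur hSinl
  rw [h59] at h58
  rw [hrel] at hdvd
  -- inexact control and the cancellation of `#Sel₀(ℚ_∞)^Γ`
  have hctrl := natCard_katoStrictSelmer_le_mul W κ hodd hκ γ hfinS
  set cS := Nat.card (katoStrictSelmer W p {primePlace p}) with hcS
  set F₀ := Nat.card {m : W.geomPrimaryTorsion p | ∀ σ ∈ κ.layerSubgroup 0, σ • m = m} with hF₀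
  set cI := Nat.card (IwasawaDual.endInvariants (W.conjFineSelmerInfty κ γ - 1)) with hcI
  obtain ⟨t, ht⟩ := hdvd
  have hI0 : cI ≠ 0 := fun h0 ↦ hrel0 (by rw [ht, h0, zero_mul])
  have ht1 : 1 ≤ t := Nat.one_le_iff_ne_zero.mpr fun h0 ↦ hrel0 (by rw [ht, h0, mul_zero])
  set a := p ^ padicValNat p W.tamagawaProduct * Nat.card (AddCommGroup.primaryComponent (↥W.sha) p) with ha
  set b := p ^ padicValNat p ((W.baseChange ((primePlace p).adicCompletion ℚ)).localTamagawaNumber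
      ((primePlace p).adicCompletionIntegers ℚ)) * p ^ e * (p ^ padicValNat p W.torsionOrder) ^ 2 with hb'
  have h1 : cI * (a * t) ≤ cI * (F₀ * b) := by
    have h58' : a * (cI * t) ≤ p ^ padicValNat p ((W.baseChange ((primePlace p).adicCompletion ℚ)).localTamagawaNumber
        ((primePlace p).adicCompletionIntegers ℚ)) * cS * p ^ e * (p ^ padicValNat p W.torsionOrder) ^ 2 := by
      rw [← ht]; exact h58
    calc cI * (a * t) = a * (cI * t) := by ring
      _ ≤ _ := h58'
      _ = cS * b := by rw [hb']; ring
      _ ≤ (F₀ * cI) * b := Nat.mul_le_mul_right _ hctrl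
      _ = cI * (F₀ * b) := by ring
  have h2 : a * t ≤ F₀ * b := Nat.le_of_mul_le_mul_left h1 (Nat.pos_of_ne_zero hI0)
  have h3 : a ≤ F₀ * b := le_trans (Nat.le_mul_of_pos_right a ht1) h2
  -- every factor is a power of `p`
  obtain ⟨s, hs⟩ := MemberHullZetaInputsOfCore.natCard_primaryComponent_eq_prime_pow p (G := ↥W.sha)
  obtain ⟨φ, hφ⟩ : ∃ φ : ℕ, F₀ = p ^ φ := natCard_fixedBy_layerSubgroup_zero_eq_prime_pow W κ (p := p)
  have h4 : p ^ (padicValNat p W.tamagawaProduct + s) ≤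
      p ^ (e + padicValNat p ((W.baseChange ((primePlace p).adicCompletion ℚ)).localTamagawaNumber
          ((primePlace p).adicCompletionIntegers ℚ)) + 2 * padicValNat p W.torsionOrder + φ) := by
    calc p ^ (padicValNat p W.tamagawaProduct + s) = a := by rw [ha, hs, pow_add]
      _ ≤ F₀ * b := h3
      _ = _ := by rw [hb', hφ, ← pow_mul, ← pow_add, ← pow_add, ← pow_add]; ring_nf
  have h5 := (Nat.pow_le_pow_iff_right hp.one_lt).mp h4
  rw [hs, hφ, padicValNat.prime_pow, padicValNat.prime_pow]
  omega

/-- **The same with `v_p #W(ℚ̄)[p^∞]^{Γ_ℚ}` absorbed into a third torsion copy**: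
`ord_p #Ш(W)[p^∞] + v_p(Tam W) ≤ e + v_p(c_p) + 3·v_p #W(ℚ)_tors` (§2: `#W(ℚ̄)[p^∞]^{Γ_ℚ} ∣ #W(ℚ)[p^∞] ∣ #W(ℚ)_tors`) — crux M's SHAPE.
[cite: Kato2004Asterisque, Prop. 14.16 (2) (pp. 244–245)] [cite: GreenbergLNM1716, §4 Lemma 4.3] -/
theorem padicValNat_sha_add_tamagawa_le_of_zetaLineOrthIndexAt_of_fineSelmer_dvd' (hodd : p ≠ 2) (hκ : κ.IsCyclotomic)
    (I : IwasawaH1Data W p κ γ) (y : I.H)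
    (hfinS : Finite (IwasawaDual.endInvariants (W.conjFineSelmerInfty κ γ - 1)))
    (hfin : Finite (integralH1 (tateRep W p) p (κ.layerSubgroup 0) ⧸
      Submodule.span ℤ_[p] {(⟨I.proj 0 y, I.proj_mem 0 y⟩ : integralH1 (tateRep W p) p (κ.layerSubgroup 0))}))
    (hdvd : Nat.card (IwasawaDual.endInvariants (W.conjFineSelmerInfty κ γ - 1)) ∣
      Nat.card (integralH1 (tateRep W p) p (κ.layerSubgroup 0) ⧸
        Submodule.span ℤ_[p] {(⟨I.proj 0 y, I.proj_mem 0 y⟩ : integralH1 (tateRep W p) p (κ.layerSubgroup 0))}))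
    (e : ℕ) (hb : ZetaLineOrthIndexAt W p (layerZeroToTop W p κ (I.proj 0 y)) e) :
    padicValNat p (Nat.card (AddCommGroup.primaryComponent W.sha p)) + padicValNat p W.tamagawaProduct ≤
      e + padicValNat p ((W.baseChange ((primePlace p).adicCompletion ℚ)).localTamagawaNumber
          ((primePlace p).adicCompletionIntegers ℚ)) + 3 * padicValNat p W.torsionOrder := by
  have h := padicValNat_sha_add_tamagawa_le_of_zetaLineOrthIndexAt_of_fineSelmer_dvd W p hodd hκ I y hfinS hfin hdvd e hb
  -- `v_p #fixed ≤ v_p #W(ℚ)_tors`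
  have hd1 : Nat.card {m : W.geomPrimaryTorsion p | ∀ σ ∈ κ.layerSubgroup 0, σ • m = m} ∣ W.torsionOrder := by
    unfold WeierstrassCurve.torsionOrder
    convert natCard_fixedBy_layerSubgroup_zero_dvd_natCard_torsion W κ (p := p) using 2
  have htO : Nat.card (AddCommGroup.torsion W.toAffine.Point) = W.torsionOrder := by
    unfold WeierstrassCurve.torsionOrder; convert rfl
  have hle : padicValNat p (Nat.card {m : W.geomPrimaryTorsion p | ∀ σ ∈ κ.layerSubgroup 0, σ • m = m}) ≤
      padicValNat p W.torsionOrder :=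
    (padicValNat_dvd_iff_le (htO ▸ Nat.card_pos.ne')).mp (pow_padicValNat_dvd.trans hd1)
  omega

end Bound

/-! ## §4 Every reducible non-CM rank-0 row with `W(ℚ_{p,∞})[p^∞]` finite — no reduction hypothesis (wild `p = 3` included) -/

section Rows

variable (W : WeierstrassCurve ℚ) [W.IsElliptic] (p : ℕ) [Fact p.Prime]
  [ContinuousSMul ℤ_[p] (W.tateModule p)] [Module.Free ℤ_[p] (W.tateModule p)]
  [Module.Finite ℤ_[p] (W.tateModule p)]
  [Finite W.toAffine.Point] [Finite (AddCommGroup.primaryComponent W.sha p)]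
  {κ : ZpExtension ℚ p} {γ : absoluteGaloisGroup ℚ}

/-- **Crux M's inequality modulo (b′) on the pinned zeta class, on EVERY reducible non-CM rank-0 row with `W(ℚ_{p,∞})[p^∞]` finite**
(the wild prime included; no reduction hypothesis): for `W/ℚ` non-CM, `p ≠ 2`, `W[p]` reducible, `W(ℚ)` and `Ш(W)[p^∞]` finite, `L(W,1) ≠ 0`,
`f` the newform of `W`, the cyclotomic `(κ, γ)`, the place `v ∣ p` with `W(ℚ_{p,∞})[p^∞]` finite, and every pin `I`: there is a non-zero
genuine Euler-system class `𝐲 ∈ 𝐇¹_Γ(T_pW)` (Kato's `(c,d)`-zeta lift) with `𝐲₀` of infinite order such that **for every `e` with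
`ZetaLineOrthIndexAt W p (layerZeroToTop 𝐲₀) e`: `ord_p #Ш(W)[p^∞] + v_p(Tam W) ≤ e + v_p(c_p) + 3·v_p #W(ℚ)_tors`** — modulo
{H2X, Z0, 13.4, Serre, FW, Lim 3.5}.  (On the wild rows Kato's own `e` contains `+ t_p`, not cancelled here: module docstring.)
[cite: Kato2004Asterisque, Thm. 12.5–12.6 (pp. 221–222), Thm. 14.5 (p. 236), (14.9.1)–(14.9.3) (pp. 239–240), Prop. 14.16 (2) (pp. 244–245), Lemma 14.18 (pp. 247–248)]
[cite: GreenbergLNM1716, §3 Lemma 3.1, §4 Lemma 4.2–4.3] [cite: MilneADT2006, Ch. I, Thm. 4.10 (b)] -/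
theorem exists_zetaLift_padicValNat_sha_add_tamagawa_le_of_zetaLineOrthIndexAt_of_finite
    (hX : exists_iwasawaH2Data_fineSelmerDual_embedding)
    (hZ0 : exists_member_eulerSystem_expStar_values)
    (h134 : thm13_4_lengthAt_fineSelmerDual_le_of_isEulerSystemClass)
    (hSerre : serre_adicImage_contains_congruenceSubgroup)
    (hLim : Lim2017.thm35_fineSelmerDual_moduleFinite_of_classicalMuVanishes_of_le_divisionField)
    (hFW : Literature.NumberTheory.IwasawaTheory.ferreroWashington1979_classicalMuVanishes)
    (hp : p ≠ 2) (hκ : κ.IsCyclotomic) (hγ : κ.IsTopGenerator γ) (hCM : ¬ W.HasCM)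
    (hred : ¬ W.HasIrreducibleModPGaloisRep p)
    (v : HeightOneSpectrum (𝓞 ℚ)) (hv : ((Rat.HeightOneSpectrum.primesEquiv v : Nat.Primes) : ℕ) = p)
    (hfin : Finite (FixedPoints.addSubgroup ↥(κ.kerSubgroup ⊓ decomp v) (W.geomPrimaryTorsion p)))
    (I : IwasawaH1Data W p κ γ) {N : ℕ} [NeZero N] (f : CuspForm (Gamma0 N) 2) (hf : IsNewformOf W f)
    (hL1 : W.entireLFunction 1 ≠ 0) (ι : (m : ℕ) → (CyclotomicField m ℚ →+* ℂ)) :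
    ∃ y : I.H, y ≠ 0 ∧ IsEulerSystemClass W p κ γ I y ∧ ¬ IsOfFinAddOrder (I.proj 0 y) ∧
      ∀ e : ℕ, ZetaLineOrthIndexAt W p (layerZeroToTop W p κ (I.proj 0 y)) e →
        padicValNat p (Nat.card (AddCommGroup.primaryComponent W.sha p)) + padicValNat p W.tamagawaProduct ≤
          e + padicValNat p ((W.baseChange ((primePlace p).adicCompletion ℚ)).localTamagawaNumber
              ((primePlace p).adicCompletionIntegers ℚ)) + 3 * padicValNat p W.torsionOrder := by
  obtain ⟨y, hy0, hES, hnt, hfinS, hfi, hdvd⟩ :=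
    ReducibleH2DescentCount.exists_zetaLift_natCard_fineSelmer_invariants_dvd_index_of_H2X W p hX hZ0 h134 hSerre hLim hFW hp hκ
      hγ hCM hred v hv hfin I f hf hL1 ι
  exact ⟨y, hy0, hES, hnt, fun e hb ↦
    padicValNat_sha_add_tamagawa_le_of_zetaLineOrthIndexAt_of_fineSelmer_dvd' W p hp hκ I y hfinS hfi hdvd e hb⟩

/-- **The LIFT form** (for a value-guarded `ZetaBody` family of the newform of a curve `V` with `L(V,1) ≠ 0` and ITS Λ-adic lift `𝐲` — the
binder under which the held package 27962 speaks of `𝐲`), on a reducible non-CM rank-0 row with `W(ℚ_{p,∞})[p^∞]` finite: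
`∀ e, ZetaLineOrthIndexAt W p (layerZeroToTop 𝐲₀) e → ord_p #Ш(W)[p^∞] + v_p(Tam W) ≤ e + v_p(c_p) + 3·v_p #W(ℚ)_tors`, modulo
{H2X, 13.4, Serre, FW, Lim 3.5}. [cite: Kato2004Asterisque, Thm. 12.5 (p. 221), Thm. 14.5 (p. 236), Prop. 14.16 (2) (pp. 244–245), Lemma 14.18 (pp. 247–248)]
[cite: GreenbergLNM1716, §3 Lemma 3.1, §4 Lemma 4.2–4.3] -/
theorem padicValNat_sha_add_tamagawa_le_of_zetaLineOrthIndexAt_zetaLift_of_finite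
    (hX : exists_iwasawaH2Data_fineSelmerDual_embedding)
    (h134 : thm13_4_lengthAt_fineSelmerDual_le_of_isEulerSystemClass)
    (hSerre : serre_adicImage_contains_congruenceSubgroup)
    (hLim : Lim2017.thm35_fineSelmerDual_moduleFinite_of_classicalMuVanishes_of_le_divisionField)
    (hFW : Literature.NumberTheory.IwasawaTheory.ferreroWashington1979_classicalMuVanishes)
    (hp : p ≠ 2) (hκ : κ.IsCyclotomic) (hγ : κ.IsTopGenerator γ) (hCM : ¬ W.HasCM)
    (hred : ¬ W.HasIrreducibleModPGaloisRep p)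
    (v : HeightOneSpectrum (𝓞 ℚ)) (hv : ((Rat.HeightOneSpectrum.primesEquiv v : Nat.Primes) : ℕ) = p)
    (hfin : Finite (FixedPoints.addSubgroup ↥(κ.kerSubgroup ⊓ decomp v) (W.geomPrimaryTorsion p)))
    (I : IwasawaH1Data W p κ γ) {N : ℕ} [NeZero N] {f : CuspForm (Gamma0 N) 2}
    {ι : (m : ℕ) → (CyclotomicField m ℚ →+* ℂ)} {κ' : ℝ}
    {Λ' : ∀ (k : ℕ) (r : Finset (HeightOneSpectrum (𝓞 ℚ))),
      H1 (tateRep W p) (cycSubgroup p k r) →ₗ[ℤ_[p]] ℚ_[p] ⊗[ℚ] CyclotomicField (cycLevel p k r) ℚ}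
    {c d a : ℤ} {A : ℕ}
    {z : ∀ (k : ℕ) (r : (cyclotomicLevelsRat p (badPlaces c d A N)).Ideals),
      H1 (tateRep W p) ((cyclotomicLevelsRat p (badPlaces c d A N)).level k r.1)}
    {x : ∀ (k : ℕ) (r : (cyclotomicLevelsRat p (badPlaces c d A N)).Ideals),
      CyclotomicField (cycLevel p k r.1) ℚ}
    (hbody : ZetaBody W p f ι κ' Λ' c d a A z x) (hne : 2 * c.natAbs * d.natAbs * A * N ≠ 0)
    {y : I.H} (hy : ∀ n : ℕ, I.proj n y = levelToLayer W p hκ hp (badPlaces c d A N) n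
      (z (n + 1) (cyclotomicLevelsRat p (badPlaces c d A N)).idealOne))
    {V : WeierstrassCurve ℚ} [V.IsElliptic] (hf : IsNewformOf V f) (hL1 : V.entireLFunction 1 ≠ 0)
    (hκ' : κ' ≠ 0) (hA : 0 < A) (d' : ℤ) (hcd : Int.gcd (c * d) A = 1) (hdd' : d * d' ≡ 1 [ZMOD (A : ℤ)])
    (hR : cuspFactor f true (fun _ ↦ 1) c d a A d' ≠ 0)
    (e : ℕ) (hb : ZetaLineOrthIndexAt W p (layerZeroToTop W p κ (I.proj 0 y)) e) :
    padicValNat p (Nat.card (AddCommGroup.primaryComponent W.sha p)) + padicValNat p W.tamagawaProduct ≤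
      e + padicValNat p ((W.baseChange ((primePlace p).adicCompletion ℚ)).localTamagawaNumber
          ((primePlace p).adicCompletionIntegers ℚ)) + 3 * padicValNat p W.torsionOrder := by
  obtain ⟨hfinS, hfi, hdvd⟩ := ReducibleH2DescentCount.natCard_fineSelmer_invariants_dvd_index_zetaLift_of_H2X W p hX h134 hSerre hLim
    hFW hp hκ hγ hCM hred v hv hfin I hbody hne hy hf hL1 hκ' hA d' hcd hdd' hR
  exact padicValNat_sha_add_tamagawa_le_of_zetaLineOrthIndexAt_of_fineSelmer_dvd' W p hp hκ I y hfinS hfi hdvd e hb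

end Rows

end Summit.BirchSwinnertonDyer.BirchSwinnertonDyer.Theorems.ReducibleShaBoundWild

end
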